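import Literature.MathematicalPhysics.QuantumFieldTheory.Balaban1983to89.B14Ineq244ChartFeed

/-!
# `Balaban1983to89.B14.Eq349IrrelevantFeed` — [Balaban1988Convergent] p. 281: «(the irrelevant terms) above, and in
# (3.49), denotes the sum of terms which can be bounded by O((LʲL⁻ⁿ)^{5−β}) exp(−κd_j(X)), where β is a positive number»
# — the 𝐄-side twin of `…B14.Ineq244ChartFeed`: the fourteen remainder terms of (3.49) in the chart of an analytic
# functional obeying (I.1.18) (`…Claim283RAnalytic.remainder349_chart_norm_le_of_analytic`, gen 10) put in PRINT'S SHAPE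
# `C·E₀·(LʲL⁻ⁿ)^{5−β}·exp(−κd_j(X))` (Hölder gain `τ = (LʲL⁻ⁿ)^{1−β}` of (I.4.18)) and SUMMED over the domains assigned to
# the point `z` by (1.26) of [II] — the `(L^{j−n})^{5−b}`-shaped irrelevant input `I₁` of `…Thm2Assembly.PointDataE` for
# this constituent, constant `C·E₀·K₀(c₀, Δ)` EXPLICIT

HONEST FRAMING (cell `lit-balaban`, verbatim): statement-level skeleton of published theorems with citation tags;
proofs where landed; nothing here is a claim about the Yang–Mills mass gap.

CITATION HEADER (lean-in-tree rule).  Source: T. Bałaban, *Convergent renormalization expansions for lattice gauge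
theories*, Commun. Math. Phys. **119** (1988) 243–285, doi:10.1007/bf01217741 [Balaban1988Convergent] (cell paper
B14 = "[III]"; PDF held `paper:balaban1988-cmp119-convergent-renormalization`, journal page = PDF page + 242; text layer
p0038/p0039 re-read by the author of this file, 2026-08-22): (3.49) p. 280 [PDF 38], the sentence on «the irrelevant
terms» p. 281 [PDF 39] tl.22–24, (2.27)(ii)/(iv) p. 259, (3.48) p. 280, (3.67) p. 283; [II] = T. Bałaban, Commun. Math.
Phys. **116** (1988) 1–22 [Balaban1988RG2Cluster], (1.26) p. 8; [I] = T. Bałaban, Commun. Math. Phys. **109** (1987)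
249–301 [Balaban1987RG1], (1.18) p. 263 (the bound `|𝐄^{(j)}(X, g_{j−1}, U, J)| ≤ E₀exp(−κd_j(X))` = «(I.1.18)» of [III]
p. 259; v1.1: v1 mis-cited it as «[II] (1.18) p. 7» / «(II.1.18)» — [II] (1.18) p. 6 is a different display, CITELOC
DELTA #11 of the cell `pub-balaban` summit-lit1 gen 44, owner-verified on the text layers p0017 L35 / CMP 109 p0015 L28),
(4.16)–(4.18) p. 285, (4.22) p. 286.  Mega-formalization `lit-balaban` (HOME
`run/shared/lean/pub/lit-balaban/`), reader/typer unit `lit-balaban-r11` (generation 11, fold owner of B14), SKELETON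
rows **B14.Eq3.49–3.50** (cell: the irrelevant terms), **B14.Eq3.67**, **B14.Thm2** (status cell).  Imports the row's own
`…B14Ineq244ChartFeed` (gen 11; through it `…B14Claim283RAnalytic`, `…B14Thm2Assembly`, `…B12TreeDecay`) and uses their
theorems BY NAME; modifies nothing; NO `def`, no new `Prop`, no named fact (D-0026: theorems only).

THE PRINTED TEXT (verbatim).  p. 280–281 [PDF 38–39]: *«… applying the Ward-Takahashi identities (I.4.14), (I.4.15),
and other operations of that section, we move the factors B to the point z instead of the point x. The final formula we
obtain is slightly different from the formula (I.4.34). We have  Σ_{n=1}^{4} (1/n!)⟨𝐄^{(n)}(X, z), B, …, B⟩ = ½ Σ … +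
(the irrelevant terms) (3.49)»*; p. 281 tl.22–24: *«Let us recall that (the irrelevant terms) above, and in (3.49),
denotes the sum of terms which can be bounded by O((LʲL⁻ⁿ)^{5−β}) exp(−κd_j(X)), where β is a positive number.»*;
p. 259 (2.27): *«(ii) there exists an analytic function 𝐄^{(j)}(X, (𝐔, 𝐉), z) … which is an extension of this term …
(iv) it satisfies the inequality (I.1.18)»*, i.e. `|𝐄^{(j)}(X, (𝐔, 𝐉), z)| ≤ E₀ exp(−κd_j(X))` ([I] (1.18) p. 263 *«|𝐄^{(j)}(X,
g_{j−1}, U, J)| ≤ E₀exp(−κd_j(X))»*, (3.48) p. 280); p. 283 (3.67): *«𝐄^{(j)}(Λ_j, U_k, z) − 𝐄^{(j)}(Λ_j, 1, z) − β_jA(h_z, U_k) = O((LʲL⁻ⁿ)^{5−β})»*; [II] (1.26)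
p. 8: *«Σ_{X∈𝐃_j, X⊃□′} exp(−κd_j(X)) ≤ O(1)»*; [I] (4.18) p. 285: *«|(∂_λ∂_νB_μ)(x)| < a₁(Lʲη)^{2+β₀}, 0 < β₀ < 1»*.

WHAT THIS FILE PROVES (theorems only).  §1 the scale algebra of print's exponent: for `σ = LʲL⁻ⁿ ∈ [0, 1]` (`L ≥ 1`,
`j ≤ n`) and `0 ≤ β ≤ 1` the Hölder factor `τ = σ^{1−β}` satisfies `σ ≤ τ ≤ 1` (the hypotheses `hστ`, `hτ1` of the
(3.49)-files) and `σ⁴·τ = σ^{5−β}` (private helpers `holder_tau_bounds`, `sigma4_mul_tau`, `sigma_pos_le_one`).  §2 `irrelevant349_le_of_chart`: the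
per-domain REAL irrelevant term `i` (any real number with `|i| ≤ ‖the fourteen remainder terms of (3.49) in the chart‖`,
the expression of `…Eq349WardReduction.eq349_chart_of_isSemisimple` / `…Claim283RAnalytic.remainder349_chart_norm_le_
of_analytic`) of a functional whose chart `B ↦ ℰ(exp ρB)` is complex-analytic on `‖B‖ < α` and bounded there by
`E₀exp(−κd_j(X))` ((2.27)(ii) + (iv) = (I.1.18), read in the chart) obeys `|i| ≤ C·E₀·σ⁴·τ·exp(−κd_j(X))` for EVERY
`C ≥ K′(a, b, α)` = the explicit polynomial `(3/2)k₂a² + (10/3)k₂a³b + (9/8)k₂a⁴b² + (5/2)k₃a³ + (33/8)k₃a⁴b + (9/4)k₄a⁴`,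
`k₂ = (4/α)²`, `k₃ = (6/α)³`, `k₄ = (8/α)⁴` (pure power counting — no gauge invariance, no semisimplicity); with
`τ = σ^{1−β}` this is VERBATIM «bounded by O((LʲL⁻ⁿ)^{5−β}) exp(−κd_j(X))» with the O(1) = `C·E₀` explicit
(`irrelevant349_le_printedShape`).  §3 `perPointIrrelevant_of_domainBounds` / `perPointIrrelevant_printedShape`: summed over
a finite family `A ⊆ {X ⊃ □_z}` of domains assigned to the point `z` by (1.26) (`…Ineq244ChartFeed.perPointR_of_subfamily`):
`|Σ_{X∈A} i(X)| ≤ (C·E₀·K₀(c₀, Δ))·(L^{j−n})^{5−β}` — the shape `c₁·(L^{j−n})^{5−b}` in which `…Thm2Assembly.PointDataE`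
consumes the irrelevant input `I₁` of the point `z`.  §4 `perPointIrrelevant_of_charts`: §2 + §3 for ONE point `z` of
scale `n` with ONE chart field `B` (pieces `λ_z, c = ∂λ_z, ℓ` at `σ = L^{j−n}`, remainder `‖B − c − ℓ‖ ≤ aσ²σ^{1−β}`)
and ONE functional `ℰ_X` per assigned domain.

HONEST SCOPE.  (1) This is ONE CONSTITUENT of «the irrelevant terms» of (3.67) — the fourteen (3.49) remainders of
[I] §4 summed over the domains at `z`; NOT here: the extension differences of (3.56)→(3.57) («contributes to the
irrelevant terms only, by the bounds (3.48)», p. 281 — cf. `…B14.Eq348ClassGeometry`, p252952), the second-class terms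
(3.48) (`…B14Eq348SecondClass`, p251207) and the relocation terms of (3.66) (estimates not printed; row B14.Thm2 status
cell).  (2) As in the imported files the chart hypotheses ((ii) + (iv) on a ball of Lie-algebra fields, radius `α`,
scalings `a` of (I.4.16)–(I.4.18), bracket bound `b`) are letters; `β` here is print's «positive number» of p. 281
(= the exponent letter `b` of `…Thm2Assembly.PointDataE`); tying it to the Hölder exponent of (I.4.18) through the
choice `τ = σ^{1−β}` of the remainder scaling is THIS FILE'S READING of the scalings (the tree's (3.49)-files carry `τ` as
a free letter with `σ ≤ τ ≤ 1`; [III] prints only the outcome «O((LʲL⁻ⁿ)^{5−β})», [I] (4.22) the analogous «(Lʲη)⁵»),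
recorded here, not a sentence of [III].  (3) Bałaban's concrete 𝐄^{(j)}(X, ·, z) is not instantiated on one carrier (row
head policy G.5-45 unchanged); nothing about the Yang–Mills mass gap.

## References
* [Balaban1988Convergent] T. Bałaban, Commun. Math. Phys. 119 (1988) 243–285: (3.49) p.280, p.281, (2.27) p.259, (3.67) p.283.
* [Balaban1988RG2Cluster] T. Bałaban, Commun. Math. Phys. 116 (1988) 1–22 ([II]: (1.26) p.8).
* [Balaban1987RG1] T. Bałaban, Commun. Math. Phys. 109 (1987) 249–301 ([I]: (1.18) p.263, (4.16)–(4.18) p.285).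
-/

open Set Metric Filter
open scoped Topology BigOperators

namespace Literature.MathematicalPhysics.QuantumFieldTheory.Balaban1983to89.B14.Eq349IrrelevantFeed

open Literature.MathematicalPhysics.QuantumFieldTheory.Balaban1983to89
open Literature.MathematicalPhysics.QuantumFieldTheory.Balaban1983to89.B12TreeDecay

/-! ## §1. The scale algebra of the exponent `5 − β`: `τ = σ^{1−β}`, `σ⁴τ = σ^{5−β}` -/

/-- For `0 ≤ σ ≤ 1` and `0 ≤ β ≤ 1` the Hölder factor `τ = σ^{1−β}` lies between `σ` and `1` — the hypotheses
`σ ≤ τ ≤ 1` of the (3.49)-files (`…Eq349WardReduction.remainder349_norm_le` and descendants). [folklore] -/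
private theorem holder_tau_bounds {σ β : ℝ} (hσ0 : 0 ≤ σ) (hσ1 : σ ≤ 1) (hβ0 : 0 ≤ β) (hβ1 : β ≤ 1) :
    σ ≤ σ ^ (1 - β) ∧ σ ^ (1 - β) ≤ 1 := by
  refine ⟨?_, Real.rpow_le_one hσ0 hσ1 (by linarith)⟩
  rcases hσ0.eq_or_lt with h | h
  · rw [← h]
    rcases eq_or_ne (1 - β) 0 with h0 | h0
    · rw [h0, Real.rpow_zero]; exact zero_le_one
    · rw [Real.zero_rpow h0]
  · calc σ = σ ^ (1 : ℝ) := (Real.rpow_one σ).symm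
      _ ≤ σ ^ (1 - β) := Real.rpow_le_rpow_of_exponent_ge h hσ1 (by linarith)

/-- `σ⁴·σ^{1−β} = σ^{5−β}` for `σ > 0` (print's exponent: four powers from the field pieces, `1 − β` from the Hölder
remainder of (I.4.18)). [folklore] -/
private theorem sigma4_mul_tau {σ β : ℝ} (hσ : 0 < σ) : σ ^ 4 * σ ^ (1 - β) = σ ^ ((5 : ℝ) - β) := by
  have e4 : σ ^ 4 = σ ^ (4 : ℝ) := by exact_mod_cast (Real.rpow_natCast σ 4).symm
  rw [e4, ← Real.rpow_add hσ]
  congr 1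
  ring

/-- The scale `σ = L^{j−n}` of a point of scale `n ≥ j` is in `(0, 1]` for `L ≥ 1`. [folklore] -/
private theorem sigma_pos_le_one {L : ℝ} (hL : 1 ≤ L) {j n : ℕ} (hjn : j ≤ n) :
    0 < L ^ ((j : ℝ) - n) ∧ L ^ ((j : ℝ) - n) ≤ 1 := by
  refine ⟨Real.rpow_pos_of_pos (lt_of_lt_of_le one_pos hL) _, Real.rpow_le_one_of_one_le_of_nonpos hL ?_⟩
  have : (j : ℝ) ≤ n := by exact_mod_cast hjn
  linarith

/-! ## §2. The per-domain irrelevant term of (3.49) from the chart bound of `…Claim283RAnalytic` -/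

section Chart

open NormedSpace (exp)

variable {𝔄 : Type*} [NormedRing 𝔄] [NormedAlgebra ℝ 𝔄] {Λ T : Type*} [Fintype Λ] [Fintype T]
  {V : Type*} [NormedAddCommGroup V] [NormedSpace ℂ V] {F : Type*} [NormedAddCommGroup F]
  [NormedSpace ℂ F] [CompleteSpace F]

/-- The explicit remainder constant `K′(a, b, α)` of `…Claim283RAnalytic.remainder349_chart_norm_le_of_analytic` (with
the sup bound `S` factored out) is nonnegative. [folklore] -/
private theorem remPoly_nonneg {a b α : ℝ} (ha : 0 ≤ a) (hb0 : 0 ≤ b) (hα : 0 < α) :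
    0 ≤ (3 / 2 : ℝ) * (4 / α) ^ 2 * a ^ 2 + (10 / 3 : ℝ) * (4 / α) ^ 2 * a ^ 3 * b
          + (9 / 8 : ℝ) * (4 / α) ^ 2 * a ^ 4 * b ^ 2
          + (5 / 2 : ℝ) * (6 / α) ^ 3 * a ^ 3 + (33 / 8 : ℝ) * (6 / α) ^ 3 * a ^ 4 * b
          + (9 / 4 : ℝ) * (8 / α) ^ 4 * a ^ 4 := by
  positivity

-- (the quadruply nested operator space over the iterated `Pi` type: one more level of pending instance synthesis)
set_option maxSynthPendingDepth 3 in
/-- **p. 281, per domain: «terms which can be bounded by O((LʲL⁻ⁿ)^{5−β}) exp(−κd_j(X))» with the O(1) explicit**: in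
the chart `f(B) = ℰ(exp ρB)` of a functional complex-analytic on `‖B‖ < α` and bounded there by `E₀exp(−κd_j(X))`
((2.27)(ii) + (iv) = (I.1.18)), with the field pieces of (I.4.16)–(I.4.18) — `‖B(z)‖, ‖λ_z‖ ≤ aσ`, `‖B(·, z)‖ ≤ aσ²`,
`‖B − B(z) − B(·, z)‖ ≤ aσ²τ`, `σ = LʲL⁻ⁿ ≤ τ ≤ 1` — ANY real `i` dominated by the norm of the fourteen remainder terms of
(3.49) (the right-hand side of `…Eq349WardReduction.eq349_chart_of_isSemisimple` minus its main term; model: the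
irrelevant part of `Σ_{n≤4}(1/n!)⟨𝐄^{(n)}(X, z), B, …, B⟩`) obeys `|i| ≤ C·E₀·σ⁴·τ·exp(−κd_j(X))` for every `C` at least the
explicit constant `K′(a, b, α)` — `…Claim283RAnalytic.remainder349_chart_norm_le_of_analytic` at `S = E₀exp(−κd_j(X))`,
`S` factored out. [cite: Balaban1988Convergent, (3.49) p.280, p.281, (2.27) p.259; Balaban1987RG1, (1.18) p.263,
(4.16)–(4.18) p.285] -/
theorem irrelevant349_le_of_chart {𝔤 : Type*} [LieRing 𝔤] [LieAlgebra ℝ 𝔤] (eV : V ≃ₗ[ℝ] 𝔤)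
    {ℰ : (Λ → T → 𝔄) → F} (ρ : V →L[ℝ] 𝔄) {α : ℝ} (hα : 0 < α) {E₀ κ dX : ℝ} (hE₀ : 0 ≤ E₀)
    (hf : AnalyticOnNhd ℂ (fun A : Λ → T → V => ℰ (fun ν y => exp (ρ (A ν y)))) (ball 0 α))
    (hS : ∀ A ∈ ball (0 : Λ → T → V) α, ‖ℰ (fun ν y => exp (ρ (A ν y)))‖ ≤ E₀ * Real.exp (-κ * dX))
    {b : ℝ} (hb0 : 0 ≤ b) (hb : ∀ x y : V, ‖eV.symm ⁅eV x, eV y⁆‖ ≤ b * ‖x‖ * ‖y‖)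
    (lam : T → V) (c ℓ B : Λ → T → V)
    {a σ τ : ℝ} (ha : 0 ≤ a) (hσ0 : 0 ≤ σ) (hσ1 : σ ≤ 1) (hστ : σ ≤ τ) (hτ1 : τ ≤ 1) (hcn : ‖c‖ ≤ a * σ)
    (hlam : ‖lam‖ ≤ a * σ) (hℓ : ‖ℓ‖ ≤ a * σ ^ 2) (hr : ‖B - c - ℓ‖ ≤ a * σ ^ 2 * τ) {C : ℝ}
    (hC : (3 / 2 : ℝ) * (4 / α) ^ 2 * a ^ 2 + (10 / 3 : ℝ) * (4 / α) ^ 2 * a ^ 3 * b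
          + (9 / 8 : ℝ) * (4 / α) ^ 2 * a ^ 4 * b ^ 2
          + (5 / 2 : ℝ) * (6 / α) ^ 3 * a ^ 3 + (33 / 8 : ℝ) * (6 / α) ^ 3 * a ^ 4 * b
          + (9 / 4 : ℝ) * (8 / α) ^ 4 * a ^ 4 ≤ C)
    {i : ℝ} (hi : |i| ≤
      ‖fderiv ℝ (fderiv ℝ (fun A : Λ → T → V => ℰ (fun ν y => exp (ρ (A ν y))))) 0 ℓ (B - c - ℓ)
          + (2 : ℝ)⁻¹ • fderiv ℝ (fderiv ℝ (fun A : Λ → T → V => ℰ (fun ν y => exp (ρ (A ν y))))) 0 (B - c - ℓ) (B - c - ℓ)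
          + (3 : ℝ)⁻¹ • fderiv ℝ (fderiv ℝ (fun A : Λ → T → V => ℰ (fun ν y => exp (ρ (A ν y))))) 0 (B - c - ℓ)
              (fun ν y => eV.symm ⁅eV (lam y), eV (c ν y)⁆)
          + (3 : ℝ)⁻¹ • fderiv ℝ (fderiv ℝ (fun A : Λ → T → V => ℰ (fun ν y => exp (ρ (A ν y))))) 0 (B - c)
              (fun ν y => eV.symm ⁅eV (lam y), eV ((B - c) ν y)⁆ - (2 : ℝ)⁻¹ • eV.symm ⁅eV ((B - c) ν y), eV (c ν y)⁆)
          + (6 : ℝ)⁻¹ • fderiv ℝ (fderiv ℝ (fderiv ℝ (fun A : Λ → T → V => ℰ (fun ν y => exp (ρ (A ν y)))))) 0 B B (B - c - ℓ)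
          + (6 : ℝ)⁻¹ • fderiv ℝ (fderiv ℝ (fderiv ℝ (fun A : Λ → T → V => ℰ (fun ν y => exp (ρ (A ν y)))))) 0 ℓ B (B - c)
          + (6 : ℝ)⁻¹ • fderiv ℝ (fderiv ℝ (fun A : Λ → T → V => ℰ (fun ν y => exp (ρ (A ν y))))) 0 ℓ
              (fun ν y => eV.symm ⁅eV (lam y), eV ((B - c) ν y)⁆ - (2 : ℝ)⁻¹ • eV.symm ⁅eV ((B - c) ν y), eV (c ν y)⁆)
          + (6 : ℝ)⁻¹ • fderiv ℝ (fderiv ℝ (fun A : Λ → T → V => ℰ (fun ν y => exp (ρ (A ν y))))) 0 (B - c)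
              (fun ν y => eV.symm ⁅eV (lam y), eV (ℓ ν y)⁆ - (2 : ℝ)⁻¹ • eV.symm ⁅eV (ℓ ν y), eV (c ν y)⁆)
          + (8 : ℝ)⁻¹ • fderiv ℝ (fderiv ℝ (fun A : Λ → T → V => ℰ (fun ν y => exp (ρ (A ν y))))) 0
              (fun ν y => eV.symm ⁅eV (lam y), eV (c ν y)⁆)
              (fun ν y => eV.symm ⁅eV (lam y), eV ((B - c) ν y)⁆ - (2 : ℝ)⁻¹ • eV.symm ⁅eV ((B - c) ν y), eV (c ν y)⁆)
          + (8 : ℝ)⁻¹ • fderiv ℝ (fderiv ℝ (fun A : Λ → T → V => ℰ (fun ν y => exp (ρ (A ν y))))) 0 (B - c)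
              (fun ν y => eV.symm ⁅eV (lam y), eV (eV.symm ⁅eV (lam y), eV (c ν y)⁆)⁆
                - (2 : ℝ)⁻¹ • eV.symm ⁅eV (eV.symm ⁅eV (lam y), eV (c ν y)⁆), eV (c ν y)⁆)
          + (8 : ℝ)⁻¹ • fderiv ℝ (fderiv ℝ (fderiv ℝ (fun A : Λ → T → V => ℰ (fun ν y => exp (ρ (A ν y)))))) 0
              (fun ν y => eV.symm ⁅eV (lam y), eV (c ν y)⁆) B (B - c)
          + (8 : ℝ)⁻¹ • fderiv ℝ (fderiv ℝ (fderiv ℝ (fun A : Λ → T → V => ℰ (fun ν y => exp (ρ (A ν y)))))) 0 B B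
              (fun ν y => eV.symm ⁅eV (lam y), eV ((B - c) ν y)⁆ - (2 : ℝ)⁻¹ • eV.symm ⁅eV ((B - c) ν y), eV (c ν y)⁆)
          - (48 : ℝ)⁻¹ • fderiv ℝ (fderiv ℝ (fun A : Λ → T → V => ℰ (fun ν y => exp (ρ (A ν y))))) 0 B
              (fun ν y => eV.symm ⁅eV (B ν y), eV (eV.symm ⁅eV ((B - c) ν y), eV (c ν y)⁆)⁆)
          + (24 : ℝ)⁻¹ • fderiv ℝ (fderiv ℝ (fderiv ℝ (fderiv ℝ (fun A : Λ → T → V => ℰ (fun ν y => exp (ρ (A ν y))))))) 0 B B B (B - c)‖) :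
    |i| ≤ C * E₀ * σ ^ 4 * τ * Real.exp (-κ * dX) := by
  have key := Claim283RAnalytic.remainder349_chart_norm_le_of_analytic eV ρ hα hf hS hb0 hb lam c ℓ B ha hσ0 hσ1
    hστ hτ1 hcn hlam hℓ hr
  have hw : 0 ≤ E₀ * Real.exp (-κ * dX) * σ ^ 4 * τ :=
    mul_nonneg (mul_nonneg (mul_nonneg hE₀ (Real.exp_nonneg _)) (pow_nonneg hσ0 4)) (hσ0.trans hστ)
  have hCw := mul_le_mul_of_nonneg_right hC hw
  refine hi.trans (key.trans ?_)
  linarith [hCw]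

-- (the quadruply nested operator space over the iterated `Pi` type: one more level of pending instance synthesis)
set_option maxSynthPendingDepth 3 in
/-- **The same in PRINT'S SHAPE `O((LʲL⁻ⁿ)^{5−β})exp(−κd_j(X))`**: at the scale `σ = L^{j−n}` of a point of scale
`n ∈ [j, ∞)` (`L ≥ 1`) with the Hölder factor `τ = σ^{1−β}`, `0 ≤ β ≤ 1` (remainder `‖B − c − ℓ‖ ≤ aσ²σ^{1−β}`, cf.
(I.4.18) «(Lʲη)^{2+β₀}»): `|i| ≤ (C·E₀)·(L^{j−n})^{5−β}·exp(−κd_j(X))`. [cite: Balaban1988Convergent, p.281, (3.49) p.280;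
Balaban1987RG1, (4.18) p.285] -/
theorem irrelevant349_le_printedShape {𝔤 : Type*} [LieRing 𝔤] [LieAlgebra ℝ 𝔤] (eV : V ≃ₗ[ℝ] 𝔤)
    {ℰ : (Λ → T → 𝔄) → F} (ρ : V →L[ℝ] 𝔄) {α : ℝ} (hα : 0 < α) {E₀ κ dX : ℝ} (hE₀ : 0 ≤ E₀)
    (hf : AnalyticOnNhd ℂ (fun A : Λ → T → V => ℰ (fun ν y => exp (ρ (A ν y)))) (ball 0 α))
    (hS : ∀ A ∈ ball (0 : Λ → T → V) α, ‖ℰ (fun ν y => exp (ρ (A ν y)))‖ ≤ E₀ * Real.exp (-κ * dX))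
    {b : ℝ} (hb0 : 0 ≤ b) (hb : ∀ x y : V, ‖eV.symm ⁅eV x, eV y⁆‖ ≤ b * ‖x‖ * ‖y‖)
    (lam : T → V) (c ℓ B : Λ → T → V) {a : ℝ} (ha : 0 ≤ a) {L : ℝ} (hL : 1 ≤ L) {j n : ℕ} (hjn : j ≤ n)
    {β : ℝ} (hβ0 : 0 ≤ β) (hβ1 : β ≤ 1) (hcn : ‖c‖ ≤ a * L ^ ((j : ℝ) - n))
    (hlam : ‖lam‖ ≤ a * L ^ ((j : ℝ) - n)) (hℓ : ‖ℓ‖ ≤ a * (L ^ ((j : ℝ) - n)) ^ 2)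
    (hr : ‖B - c - ℓ‖ ≤ a * (L ^ ((j : ℝ) - n)) ^ 2 * (L ^ ((j : ℝ) - n)) ^ (1 - β)) {C : ℝ}
    (hC : (3 / 2 : ℝ) * (4 / α) ^ 2 * a ^ 2 + (10 / 3 : ℝ) * (4 / α) ^ 2 * a ^ 3 * b
          + (9 / 8 : ℝ) * (4 / α) ^ 2 * a ^ 4 * b ^ 2
          + (5 / 2 : ℝ) * (6 / α) ^ 3 * a ^ 3 + (33 / 8 : ℝ) * (6 / α) ^ 3 * a ^ 4 * b
          + (9 / 4 : ℝ) * (8 / α) ^ 4 * a ^ 4 ≤ C)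
    {i : ℝ} (hi : |i| ≤
      ‖fderiv ℝ (fderiv ℝ (fun A : Λ → T → V => ℰ (fun ν y => exp (ρ (A ν y))))) 0 ℓ (B - c - ℓ)
          + (2 : ℝ)⁻¹ • fderiv ℝ (fderiv ℝ (fun A : Λ → T → V => ℰ (fun ν y => exp (ρ (A ν y))))) 0 (B - c - ℓ) (B - c - ℓ)
          + (3 : ℝ)⁻¹ • fderiv ℝ (fderiv ℝ (fun A : Λ → T → V => ℰ (fun ν y => exp (ρ (A ν y))))) 0 (B - c - ℓ)
              (fun ν y => eV.symm ⁅eV (lam y), eV (c ν y)⁆)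
          + (3 : ℝ)⁻¹ • fderiv ℝ (fderiv ℝ (fun A : Λ → T → V => ℰ (fun ν y => exp (ρ (A ν y))))) 0 (B - c)
              (fun ν y => eV.symm ⁅eV (lam y), eV ((B - c) ν y)⁆ - (2 : ℝ)⁻¹ • eV.symm ⁅eV ((B - c) ν y), eV (c ν y)⁆)
          + (6 : ℝ)⁻¹ • fderiv ℝ (fderiv ℝ (fderiv ℝ (fun A : Λ → T → V => ℰ (fun ν y => exp (ρ (A ν y)))))) 0 B B (B - c - ℓ)
          + (6 : ℝ)⁻¹ • fderiv ℝ (fderiv ℝ (fderiv ℝ (fun A : Λ → T → V => ℰ (fun ν y => exp (ρ (A ν y)))))) 0 ℓ B (B - c)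
          + (6 : ℝ)⁻¹ • fderiv ℝ (fderiv ℝ (fun A : Λ → T → V => ℰ (fun ν y => exp (ρ (A ν y))))) 0 ℓ
              (fun ν y => eV.symm ⁅eV (lam y), eV ((B - c) ν y)⁆ - (2 : ℝ)⁻¹ • eV.symm ⁅eV ((B - c) ν y), eV (c ν y)⁆)
          + (6 : ℝ)⁻¹ • fderiv ℝ (fderiv ℝ (fun A : Λ → T → V => ℰ (fun ν y => exp (ρ (A ν y))))) 0 (B - c)
              (fun ν y => eV.symm ⁅eV (lam y), eV (ℓ ν y)⁆ - (2 : ℝ)⁻¹ • eV.symm ⁅eV (ℓ ν y), eV (c ν y)⁆)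
          + (8 : ℝ)⁻¹ • fderiv ℝ (fderiv ℝ (fun A : Λ → T → V => ℰ (fun ν y => exp (ρ (A ν y))))) 0
              (fun ν y => eV.symm ⁅eV (lam y), eV (c ν y)⁆)
              (fun ν y => eV.symm ⁅eV (lam y), eV ((B - c) ν y)⁆ - (2 : ℝ)⁻¹ • eV.symm ⁅eV ((B - c) ν y), eV (c ν y)⁆)
          + (8 : ℝ)⁻¹ • fderiv ℝ (fderiv ℝ (fun A : Λ → T → V => ℰ (fun ν y => exp (ρ (A ν y))))) 0 (B - c)
              (fun ν y => eV.symm ⁅eV (lam y), eV (eV.symm ⁅eV (lam y), eV (c ν y)⁆)⁆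
                - (2 : ℝ)⁻¹ • eV.symm ⁅eV (eV.symm ⁅eV (lam y), eV (c ν y)⁆), eV (c ν y)⁆)
          + (8 : ℝ)⁻¹ • fderiv ℝ (fderiv ℝ (fderiv ℝ (fun A : Λ → T → V => ℰ (fun ν y => exp (ρ (A ν y)))))) 0
              (fun ν y => eV.symm ⁅eV (lam y), eV (c ν y)⁆) B (B - c)
          + (8 : ℝ)⁻¹ • fderiv ℝ (fderiv ℝ (fderiv ℝ (fun A : Λ → T → V => ℰ (fun ν y => exp (ρ (A ν y)))))) 0 B B
              (fun ν y => eV.symm ⁅eV (lam y), eV ((B - c) ν y)⁆ - (2 : ℝ)⁻¹ • eV.symm ⁅eV ((B - c) ν y), eV (c ν y)⁆)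
          - (48 : ℝ)⁻¹ • fderiv ℝ (fderiv ℝ (fun A : Λ → T → V => ℰ (fun ν y => exp (ρ (A ν y))))) 0 B
              (fun ν y => eV.symm ⁅eV (B ν y), eV (eV.symm ⁅eV ((B - c) ν y), eV (c ν y)⁆)⁆)
          + (24 : ℝ)⁻¹ • fderiv ℝ (fderiv ℝ (fderiv ℝ (fderiv ℝ (fun A : Λ → T → V => ℰ (fun ν y => exp (ρ (A ν y))))))) 0 B B B (B - c)‖) :
    |i| ≤ (C * E₀) * (L ^ ((j : ℝ) - n)) ^ ((5 : ℝ) - β) * Real.exp (-κ * dX) := by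
  obtain ⟨hσpos, hσ1⟩ := sigma_pos_le_one hL hjn
  obtain ⟨hστ, hτ1⟩ := holder_tau_bounds hσpos.le hσ1 hβ0 hβ1
  have h := irrelevant349_le_of_chart eV ρ hα hE₀ hf hS hb0 hb lam c ℓ B ha hσpos.le hσ1 hστ hτ1 hcn hlam hℓ hr hC hi
  rw [← sigma4_mul_tau hσpos]
  calc |i| ≤ C * E₀ * (L ^ ((j : ℝ) - n)) ^ 4 * (L ^ ((j : ℝ) - n)) ^ (1 - β) * Real.exp (-κ * dX) := h
    _ = (C * E₀) * ((L ^ ((j : ℝ) - n)) ^ 4 * (L ^ ((j : ℝ) - n)) ^ (1 - β)) * Real.exp (-κ * dX) := by ring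

end Chart

/-! ## §3. Summation over the domains assigned to the point `z` by (1.26) of [II] -/

section PerPoint

variable {Sy : LocDomainSys} (G : CubeSystem Sy)

/-- **Per point, from per-domain bounds**: if the domains `X` of a finite family `A ⊆ {X ⊃ □_z}` contribute real
irrelevant terms with `|i(X)| ≤ c·σ⁴·τ·exp(−κd_j(X))` (`τ ≥ 0`), then `|Σ_{X∈A} i(X)| ≤ c·K₀(c₀, Δ)·σ⁴·τ` for
`κ ≥ κ₀(c₀, Δ)` — (1.26) of [II] over the sub-family (`…Ineq244ChartFeed.perPointR_of_subfamily` with the coupling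
power replaced by `τ¹`). [cite: Balaban1988Convergent, p.281, (3.67) p.283; Balaban1988RG2Cluster, (1.26) p.8] -/
theorem perPointIrrelevant_of_domainBounds {Δ : ℕ} (hΔ : G.DegreeLE Δ) {c₀ : ℝ} (hV : G.VolumeLeaf c₀) {κ : ℝ}
    (hκ : kappa₀ c₀ Δ ≤ κ) {A : Finset Sy.Dom} {cz : G.Cube} (hA : A ⊆ G.above cz) {i : Sy.Dom → ℝ}
    {c σ τ : ℝ} (hc : 0 ≤ c) (hσ : 0 ≤ σ) (hτ : 0 ≤ τ)
    (hi : ∀ X ∈ A, |i X| ≤ c * σ ^ 4 * τ * Real.exp (-κ * Sy.dj X)) :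
    |∑ X ∈ A, i X| ≤ c * K₀ c₀ Δ * σ ^ 4 * τ := by
  have h := Ineq244ChartFeed.perPointR_of_subfamily G hΔ hV hκ hA (κ₀' := 1) hc hσ hτ
    (fun X hX => by rw [pow_one]; exact hi X hX)
  simpa only [pow_one] using h

/-- **Per point, PRINT'S SHAPE**: at `σ = L^{j−n}` (`L ≥ 1`, `j ≤ n`), `τ = σ^{1−β}` (`0 ≤ β ≤ 1`):
`|Σ_{X∈A} i(X)| ≤ (c·K₀(c₀, Δ))·(L^{j−n})^{5−β}` — the shape `c₁·(L^{j−n})^{5−b}` of the irrelevant input `I₁` of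
`…Thm2Assembly.PointDataE` (there `b` = this `β`). [cite: Balaban1988Convergent, p.281, (3.67) p.283;
Balaban1988RG2Cluster, (1.26) p.8] -/
theorem perPointIrrelevant_printedShape {Δ : ℕ} (hΔ : G.DegreeLE Δ) {c₀ : ℝ} (hV : G.VolumeLeaf c₀) {κ : ℝ}
    (hκ : kappa₀ c₀ Δ ≤ κ) {A : Finset Sy.Dom} {cz : G.Cube} (hA : A ⊆ G.above cz) {i : Sy.Dom → ℝ}
    {c L β : ℝ} (hc : 0 ≤ c) (hL : 1 ≤ L) {j n : ℕ} (hjn : j ≤ n)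
    (hi : ∀ X ∈ A, |i X| ≤ c * (L ^ ((j : ℝ) - n)) ^ 4 * (L ^ ((j : ℝ) - n)) ^ (1 - β) * Real.exp (-κ * Sy.dj X)) :
    |∑ X ∈ A, i X| ≤ (c * K₀ c₀ Δ) * (L ^ ((j : ℝ) - n)) ^ ((5 : ℝ) - β) := by
  obtain ⟨hσpos, _⟩ := sigma_pos_le_one hL hjn
  have h := perPointIrrelevant_of_domainBounds G hΔ hV hκ hA hc hσpos.le (Real.rpow_nonneg hσpos.le _) hi
  rw [← sigma4_mul_tau hσpos]
  calc |∑ X ∈ A, i X| ≤ c * K₀ c₀ Δ * (L ^ ((j : ℝ) - n)) ^ 4 * (L ^ ((j : ℝ) - n)) ^ (1 - β) := h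
    _ = (c * K₀ c₀ Δ) * ((L ^ ((j : ℝ) - n)) ^ 4 * (L ^ ((j : ℝ) - n)) ^ (1 - β)) := by ring

end PerPoint

/-! ## §4. One point `z`: the (3.49) irrelevant terms of its assigned domains from a family of charts -/

section ChartPoint

open NormedSpace (exp)

variable {𝔄 : Type*} [NormedRing 𝔄] [NormedAlgebra ℝ 𝔄] {Λ T : Type*} [Fintype Λ] [Fintype T]
  {V : Type*} [NormedAddCommGroup V] [NormedSpace ℂ V] {F : Type*} [NormedAddCommGroup F]
  [NormedSpace ℂ F] [CompleteSpace F]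

-- (the quadruply nested operator space over the iterated `Pi` type: one more level of pending instance synthesis)
set_option maxSynthPendingDepth 3 in
/-- **p. 281 summed at the point `z`** (the `(L^{j−n})^{5−β}`-shaped irrelevant input of (3.67) for this
constituent): ONE point `z` of scale `n ≥ j` with its cube `□_z`, a finite family `A ⊆ {X ⊃ □_z}` of first-class
domains assigned to it, ONE functional `ℰ_X` per domain whose chart `B ↦ ℰ_X(exp ρB)` is complex-analytic on
`‖B‖ < α` and bounded there by `E₀exp(−κd_j(X))` ((2.27)(ii) + (iv)), ONE chart field `B` at `z` with its
(I.4.16)–(I.4.18) pieces `λ_z, c, ℓ` at `σ = L^{j−n}` and Hölder remainder `‖B − c − ℓ‖ ≤ aσ²σ^{1−β}`, real terms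
`|i(X)| ≤ ‖the fourteen (3.49) remainders of ℰ_X at B‖`: then `|Σ_{X∈A} i(X)| ≤ (C·E₀·K₀(c₀, Δ))·(L^{j−n})^{5−β}`, `C` any
number at least the explicit `K′(a, b, α)`. [cite: Balaban1988Convergent, p.281, (3.49) p.280, (3.67) p.283, (2.27)
p.259; Balaban1988RG2Cluster, (1.26) p.8; Balaban1987RG1, (1.18) p.263, (4.16)–(4.18) p.285] -/
theorem perPointIrrelevant_of_charts
    {Sy : LocDomainSys} (G : CubeSystem Sy) {Δ : ℕ} (hΔ : G.DegreeLE Δ) {c₀ : ℝ} (hV : G.VolumeLeaf c₀) {κ : ℝ}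
    (hκ : kappa₀ c₀ Δ ≤ κ)
    {𝔤 : Type*} [LieRing 𝔤] [LieAlgebra ℝ 𝔤] (eV : V ≃ₗ[ℝ] 𝔤) (ρ : V →L[ℝ] 𝔄) {α : ℝ} (hα : 0 < α) {E₀ : ℝ}
    (hE₀ : 0 ≤ E₀) {b : ℝ} (hb0 : 0 ≤ b) (hb : ∀ x y : V, ‖eV.symm ⁅eV x, eV y⁆‖ ≤ b * ‖x‖ * ‖y‖)
    {a : ℝ} (ha : 0 ≤ a) {C : ℝ}
    (hC : (3 / 2 : ℝ) * (4 / α) ^ 2 * a ^ 2 + (10 / 3 : ℝ) * (4 / α) ^ 2 * a ^ 3 * b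
          + (9 / 8 : ℝ) * (4 / α) ^ 2 * a ^ 4 * b ^ 2
          + (5 / 2 : ℝ) * (6 / α) ^ 3 * a ^ 3 + (33 / 8 : ℝ) * (6 / α) ^ 3 * a ^ 4 * b
          + (9 / 4 : ℝ) * (8 / α) ^ 4 * a ^ 4 ≤ C)
    {L : ℝ} (hL : 1 ≤ L) {j n : ℕ} (hjn : j ≤ n) {β : ℝ} (hβ0 : 0 ≤ β) (hβ1 : β ≤ 1)
    {A : Finset Sy.Dom} {cz : G.Cube} (hA : A ⊆ G.above cz)
    (ℰ : Sy.Dom → (Λ → T → 𝔄) → F)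
    (hf : ∀ X ∈ A, AnalyticOnNhd ℂ (fun A' : Λ → T → V => ℰ X (fun ν y => exp (ρ (A' ν y)))) (ball 0 α))
    (hS : ∀ X ∈ A, ∀ A' ∈ ball (0 : Λ → T → V) α,
      ‖ℰ X (fun ν y => exp (ρ (A' ν y)))‖ ≤ E₀ * Real.exp (-κ * Sy.dj X))
    (lam : T → V) (c ℓ B : Λ → T → V) (hcn : ‖c‖ ≤ a * L ^ ((j : ℝ) - n))
    (hlam : ‖lam‖ ≤ a * L ^ ((j : ℝ) - n)) (hℓ : ‖ℓ‖ ≤ a * (L ^ ((j : ℝ) - n)) ^ 2)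
    (hr : ‖B - c - ℓ‖ ≤ a * (L ^ ((j : ℝ) - n)) ^ 2 * (L ^ ((j : ℝ) - n)) ^ (1 - β))
    (i : Sy.Dom → ℝ) (hi : ∀ X ∈ A, |i X| ≤
      ‖fderiv ℝ (fderiv ℝ (fun A' : Λ → T → V => ℰ X (fun ν y => exp (ρ (A' ν y))))) 0 ℓ (B - c - ℓ)
          + (2 : ℝ)⁻¹ • fderiv ℝ (fderiv ℝ (fun A' : Λ → T → V => ℰ X (fun ν y => exp (ρ (A' ν y))))) 0 (B - c - ℓ) (B - c - ℓ)
          + (3 : ℝ)⁻¹ • fderiv ℝ (fderiv ℝ (fun A' : Λ → T → V => ℰ X (fun ν y => exp (ρ (A' ν y))))) 0 (B - c - ℓ)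
              (fun ν y => eV.symm ⁅eV (lam y), eV (c ν y)⁆)
          + (3 : ℝ)⁻¹ • fderiv ℝ (fderiv ℝ (fun A' : Λ → T → V => ℰ X (fun ν y => exp (ρ (A' ν y))))) 0 (B - c)
              (fun ν y => eV.symm ⁅eV (lam y), eV ((B - c) ν y)⁆ - (2 : ℝ)⁻¹ • eV.symm ⁅eV ((B - c) ν y), eV (c ν y)⁆)
          + (6 : ℝ)⁻¹ • fderiv ℝ (fderiv ℝ (fderiv ℝ (fun A' : Λ → T → V => ℰ X (fun ν y => exp (ρ (A' ν y)))))) 0 B B (B - c - ℓ)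
          + (6 : ℝ)⁻¹ • fderiv ℝ (fderiv ℝ (fderiv ℝ (fun A' : Λ → T → V => ℰ X (fun ν y => exp (ρ (A' ν y)))))) 0 ℓ B (B - c)
          + (6 : ℝ)⁻¹ • fderiv ℝ (fderiv ℝ (fun A' : Λ → T → V => ℰ X (fun ν y => exp (ρ (A' ν y))))) 0 ℓ
              (fun ν y => eV.symm ⁅eV (lam y), eV ((B - c) ν y)⁆ - (2 : ℝ)⁻¹ • eV.symm ⁅eV ((B - c) ν y), eV (c ν y)⁆)
          + (6 : ℝ)⁻¹ • fderiv ℝ (fderiv ℝ (fun A' : Λ → T → V => ℰ X (fun ν y => exp (ρ (A' ν y))))) 0 (B - c)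
              (fun ν y => eV.symm ⁅eV (lam y), eV (ℓ ν y)⁆ - (2 : ℝ)⁻¹ • eV.symm ⁅eV (ℓ ν y), eV (c ν y)⁆)
          + (8 : ℝ)⁻¹ • fderiv ℝ (fderiv ℝ (fun A' : Λ → T → V => ℰ X (fun ν y => exp (ρ (A' ν y))))) 0
              (fun ν y => eV.symm ⁅eV (lam y), eV (c ν y)⁆)
              (fun ν y => eV.symm ⁅eV (lam y), eV ((B - c) ν y)⁆ - (2 : ℝ)⁻¹ • eV.symm ⁅eV ((B - c) ν y), eV (c ν y)⁆)
          + (8 : ℝ)⁻¹ • fderiv ℝ (fderiv ℝ (fun A' : Λ → T → V => ℰ X (fun ν y => exp (ρ (A' ν y))))) 0 (B - c)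
              (fun ν y => eV.symm ⁅eV (lam y), eV (eV.symm ⁅eV (lam y), eV (c ν y)⁆)⁆
                - (2 : ℝ)⁻¹ • eV.symm ⁅eV (eV.symm ⁅eV (lam y), eV (c ν y)⁆), eV (c ν y)⁆)
          + (8 : ℝ)⁻¹ • fderiv ℝ (fderiv ℝ (fderiv ℝ (fun A' : Λ → T → V => ℰ X (fun ν y => exp (ρ (A' ν y)))))) 0
              (fun ν y => eV.symm ⁅eV (lam y), eV (c ν y)⁆) B (B - c)
          + (8 : ℝ)⁻¹ • fderiv ℝ (fderiv ℝ (fderiv ℝ (fun A' : Λ → T → V => ℰ X (fun ν y => exp (ρ (A' ν y)))))) 0 B B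
              (fun ν y => eV.symm ⁅eV (lam y), eV ((B - c) ν y)⁆ - (2 : ℝ)⁻¹ • eV.symm ⁅eV ((B - c) ν y), eV (c ν y)⁆)
          - (48 : ℝ)⁻¹ • fderiv ℝ (fderiv ℝ (fun A' : Λ → T → V => ℰ X (fun ν y => exp (ρ (A' ν y))))) 0 B
              (fun ν y => eV.symm ⁅eV (B ν y), eV (eV.symm ⁅eV ((B - c) ν y), eV (c ν y)⁆)⁆)
          + (24 : ℝ)⁻¹ • fderiv ℝ (fderiv ℝ (fderiv ℝ (fderiv ℝ (fun A' : Λ → T → V => ℰ X (fun ν y => exp (ρ (A' ν y))))))) 0 B B B (B - c)‖) :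
    |∑ X ∈ A, i X| ≤ (C * E₀ * K₀ c₀ Δ) * (L ^ ((j : ℝ) - n)) ^ ((5 : ℝ) - β) := by
  have hC0 : 0 ≤ C := (remPoly_nonneg ha hb0 hα).trans hC
  refine perPointIrrelevant_printedShape G hΔ hV hκ hA (mul_nonneg hC0 hE₀) hL hjn (fun X hX => ?_)
  obtain ⟨hσpos, hσ1⟩ := sigma_pos_le_one hL hjn
  obtain ⟨hστ, hτ1⟩ := holder_tau_bounds hσpos.le hσ1 hβ0 hβ1
  exact irrelevant349_le_of_chart eV ρ hα hE₀ (hf X hX) (hS X hX) hb0 hb lam c ℓ B ha hσpos.le hσ1 hστ hτ1 hcn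
    hlam hℓ hr hC (hi X hX)

end ChartPoint

end Literature.MathematicalPhysics.QuantumFieldTheory.Balaban1983to89.B14.Eq349IrrelevantFeed
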